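import Summits.BirchSwinnertonDyer.Rank1Residual.GaloisImage.KolyvaginCoreVertices
import HarnessLib

/-!
# Core vertices at `m = 1`: one step along the Selmer graph and the edges of `X⁰`
# (Rubin, PCMI Prop. 2.6.1 / Cor. 2.6.2 / proof of Thm. 2.8.5; Sakamoto, JTNB 36 (2024) Lemma 6.1
# and the definition of `X⁰`, §6 — the case `R = 𝔽_p`)
# (cell `b2b-bsdres`, team n1011, row T-R1-56-G, file G1b; seat p11; skeleton
# `cells/n1011/skel/T-R1-56-G.md`)

HONEST FRAMING (verbatim for the cell): research route; prove what is provable now; no claim beyond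
stated classes; nothing booked; no mark / label moved.  TOOL theorems, no definition, no named fact.
Setting as in `KolyvaginCoreVertices.lean` (= R1-16's); `H(n) = H¹_{𝓕(n)}(K, M)`,
`H^*(n) = H¹_{𝓕(n)^*}(K, M^D)`; a CORE VERTEX is a level `n` with `H^*(n) = 0` (Rubin Def. 2.5.3 at
`χ = 1`; Sakamoto §6 "`λ^*(d) = 0`").
* §4 for `𝔮 ∉ n` a class vanishing at `𝔮` lies in `H(n𝔮)` iff it lies in `H(n)` (Rubin
  Prop. 2.6.1: both are `H¹_{𝓕_𝔮(n)}`); hence **Sakamoto Lemma 6.1 (1)(2) at `m = 1`**: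
  `#H(n𝔮) ≤ p·#H(n)`, `#H(n) ≤ p·#H(n𝔮)`, the same for `H^*` when `χ = 1`, and
  `#H^*(1) ≤ p^{ν(n)}·#H^*(n)` ("`ν(d) ≥ λ^*(1)` if `λ^*(d) = 0`").
* §5 **the `m = 1` edge criterion** (Rubin Def. 2.8.6; Sakamoto §6: "we join `d` and `d𝔮` by an
  edge in `X⁰` if and only if `H¹_{𝓕(d)}(K,T̄) ≠ H¹_{𝓕_𝔮(d)}(K,T̄)`"): (M1) `n` core and
  `loc_𝔮 H(n) ≠ 0` ⟹ `n𝔮` core, `loc_𝔮` injective on `H(n𝔮)`; (M2) the converse from `n𝔮`;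
  (F4) (Lemma 6.1 (4)) `#H^*(e) = p` and a θ-transported dual class non-zero at `r ∉ e` ⟹ `er` core.

References: [Rubin2011] Lecture 2, Prop. 2.6.1, Cor. 2.6.2, Def. 2.8.6, Thm. 2.8.5 (pp. 22–25);
[Sakamoto2024] Lemma 6.1, §6 (pp. 930–931); Mazur–Rubin, Mem. AMS 799 (2004) Lemma 4.1.7 (not held).
-/

noncomputable section

open scoped Classical NumberField ContRepresentation
open Function NumberField IsDedekindDomain
open Literature.NumberTheory.GaloisRepresentations Literature.NumberTheory.GaloisRepresentations.DiscreteGaloisModule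
  Literature.NumberTheory.GaloisCohomology
open Summit.BirchSwinnertonDyer.Rank1Residual.GaloisImage.CoreRankZero
open Summit.BirchSwinnertonDyer.Rank1Residual.X11b.Levels

universe u

namespace Summit.BirchSwinnertonDyer.Rank1Residual.GaloisImage.CoreRankOne

variable {K : Type u} [Field K] [NumberField K]
variable {M : Type u} [AddCommGroup M] [TopologicalSpace M] [DiscreteTopology M] [Finite M]
variable {ρ : DiscreteGaloisModule K M}

/-! ## §4. The kernel of localisation along a level; Sakamoto's Lemma 6.1 (1)(2) at `m = 1` -/

omit [Finite M] in
/-- **`H(n𝔮) ∩ ker loc_𝔮 = H(n) ∩ ker loc_𝔮`** (both are `H¹_{𝓕_𝔮(n)}(K, M)`; Rubin Prop. 2.6.1: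
"`H¹_{𝓕_ℓ(n)}(ℚ,A) = ker[H¹_{𝓕(n)}(ℚ,A) → H¹_u(ℚ_ℓ,A)]`" and `H¹_{𝓕(n)} ∩ H¹_{𝓕(nℓ)} = H¹_{𝓕_ℓ(n)}`):
a class vanishing at `𝔮 ∉ n` lies in `H(n𝔮)` iff it lies in `H(n)`.
[cite: Rubin2011, Prop. 2.6.1, proof (p. 22)] -/
theorem mem_selmerGroup_atLevel_insert_iff_of_localization_eq_zero (D : KolyvaginDatum ρ)
    (𝓕 : SelmerStructure ρ) (n : Finset (HeightOneSpectrum (𝓞 K))) (q : HeightOneSpectrum (𝓞 K))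
    {x : galoisCohomology ρ 1} (hx0 : galoisCohomology.localization ρ (Sum.inr q) 1 x = 0) :
    x ∈ (D.atLevel 𝓕 (insert q n)).selmerGroup ↔ x ∈ (D.atLevel 𝓕 n).selmerGroup := by
  refine ⟨fun hx => mem_selmerGroup_of_forall_ne q
      (fun v hv => (Level.atLevel_insert_apply_of_ne D 𝓕 q hv).le) hx ?_,
    fun hx => mem_selmerGroup_of_forall_ne q
      (fun v hv => (Level.atLevel_insert_apply_of_ne D 𝓕 q hv).symm.le) hx ?_⟩
  · rw [hx0]; exact zero_mem _
  · rw [hx0]; exact zero_mem _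

/-- **One-place counting bound**: if every class of `H¹_{𝓛′}(K, M)` vanishing at `𝔮` lies in
`H¹_𝓛(K, M)`, then `#H¹_{𝓛′} ≤ #𝓛′_𝔮 · #H¹_𝓛` (the kernel of `loc_𝔮` on `H¹_{𝓛′}` injects into `H¹_𝓛`
and its image into `𝓛′_𝔮`; Rubin Cor. 2.6.2 (1) "`|λ(nℓ, A) − λ(n, A)| ≤ m`", here `m = 1`).
[cite: Rubin2011, Cor. 2.6.2 (1) (p. 22)] -/
theorem natCard_selmerGroup_le_mul_of_ker_loc_le {𝓛 𝓛' : SelmerStructure ρ}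
    (q : HeightOneSpectrum (𝓞 K)) [Finite 𝓛.selmerGroup]
    (hker : ∀ x ∈ 𝓛'.selmerGroup, galoisCohomology.localization ρ (Sum.inr q) 1 x = 0 →
      x ∈ 𝓛.selmerGroup) :
    Nat.card 𝓛'.selmerGroup ≤ Nat.card (𝓛' (Sum.inr q)) * Nat.card 𝓛.selmerGroup := by
  haveI := finite_galoisCohomology_one_toLocal ρ q
  -- `loc_𝔮` restricted to `H¹_{𝓛′}`, with values in `𝓛′_𝔮`
  let φ : 𝓛'.selmerGroup →+ 𝓛' (Sum.inr q) :=
    ((galoisCohomology.localization ρ (Sum.inr q) 1).comp 𝓛'.selmerGroup.subtype).codRestrict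
      (𝓛' (Sum.inr q)) fun x => (SelmerStructure.mem_selmerGroup_iff _ _).1 x.2 (Sum.inr q)
  have hφ : ∀ x : 𝓛'.selmerGroup, (φ x : galoisCohomology (ρ.toLocal (Sum.inr q)) 1) =
      galoisCohomology.localization ρ (Sum.inr q) 1 x := fun x => rfl
  rw [AddSubgroup.card_eq_card_quotient_mul_card_addSubgroup φ.ker,
    Nat.card_congr (QuotientAddGroup.quotientKerEquivRange φ).toEquiv]
  refine Nat.mul_le_mul (AddSubgroup.card_le_card_addGroup _) ?_
  refine Nat.card_le_card_of_injective (fun x : φ.ker => (⟨(x.1 : galoisCohomology ρ 1),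
    hker _ x.1.2 (by rw [← hφ]; exact congrArg Subtype.val ((AddMonoidHom.mem_ker).1 x.2))⟩ :
      𝓛.selmerGroup)) ?_
  intro x y hxy
  have h := congrArg Subtype.val hxy
  exact Subtype.ext (Subtype.ext h)

/-- If `loc_𝔮` is injective on `H¹_{𝓛′}(K, M)` then `#H¹_{𝓛′} ≤ #𝓛′_𝔮`. [folklore] -/
theorem natCard_selmerGroup_le_of_loc_injective {𝓛' : SelmerStructure ρ}
    (q : HeightOneSpectrum (𝓞 K))
    (hinj : ∀ x ∈ 𝓛'.selmerGroup, galoisCohomology.localization ρ (Sum.inr q) 1 x = 0 → x = 0) :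
    Nat.card 𝓛'.selmerGroup ≤ Nat.card (𝓛' (Sum.inr q)) := by
  haveI := finite_galoisCohomology_one_toLocal ρ q
  refine Nat.card_le_card_of_injective (fun x : 𝓛'.selmerGroup =>
    (⟨galoisCohomology.localization ρ (Sum.inr q) 1 x,
      (SelmerStructure.mem_selmerGroup_iff _ _).1 x.2 (Sum.inr q)⟩ : 𝓛' (Sum.inr q))) ?_
  intro x y hxy
  have h : galoisCohomology.localization ρ (Sum.inr q) 1 (x - y : galoisCohomology ρ 1) = 0 := by
    rw [map_sub, sub_eq_zero]; exact congrArg Subtype.val hxy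
  exact Subtype.ext (sub_eq_zero.1 (hinj _ (sub_mem x.2 y.2) h))

/-- **Sakamoto Lemma 6.1 (1) at `m = 1`, upward: `#H(n𝔮) ≤ p · #H(n)`** (`#H¹_tr(K_𝔮, M) = p`).
[cite: Sakamoto2024, Lemma 6.1 (1) (p. 930)] [cite: Rubin2011, Cor. 2.6.2 (1) (p. 22)] -/
theorem natCard_selmerGroup_atLevel_insert_le {p : ℕ} {𝓕 : SelmerStructure ρ}
    (hfin : Finite 𝓕.selmerGroup) {D : KolyvaginDatum ρ}
    (hT : ∀ q ∈ D.primes, Nat.card (D.transverse (Sum.inr q)) = p)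
    (n : Finset (HeightOneSpectrum (𝓞 K))) {q : HeightOneSpectrum (𝓞 K)} (hq : q ∈ D.primes) :
    Nat.card (D.atLevel 𝓕 (insert q n)).selmerGroup ≤ p * Nat.card (D.atLevel 𝓕 n).selmerGroup := by
  haveI := finite_selmerGroup_atLevel D 𝓕 hfin n
  have h := natCard_selmerGroup_le_mul_of_ker_loc_le (𝓛 := D.atLevel 𝓕 n)
    (𝓛' := D.atLevel 𝓕 (insert q n)) q
    (fun x hx hx0 => (mem_selmerGroup_atLevel_insert_iff_of_localization_eq_zero D 𝓕 n q hx0).1 hx)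
  rwa [Level.atLevel_insert_inr_self, hT q hq] at h

/-- **Sakamoto Lemma 6.1 (1) at `m = 1`, downward: `#H(n) ≤ p · #H(n𝔮)`** for `𝔮 ∈ 𝒫 ∖ n`
(`𝓕(n)_𝔮 = H¹_ur(K_𝔮, M)` has order `p`). [cite: Sakamoto2024, Lemma 6.1 (1) (p. 930)]
[cite: Rubin2011, Cor. 2.6.2 (1) (p. 22)] -/
theorem natCard_selmerGroup_atLevel_le_insert {p : ℕ} {S : Finset (Place K)}
    {𝓕 : SelmerStructure ρ} (h𝓕 : 𝓕.IsUnramifiedOutside S) (hfin : Finite 𝓕.selmerGroup)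
    {D : KolyvaginDatum ρ} (hPS : ∀ q ∈ D.primes, (Sum.inr q : Place K) ∉ S)
    (hU : ∀ q ∈ D.primes, Nat.card (unramifiedSubgroup (GaloisRep.toLocal q ρ) 1) = p)
    (n : Finset (HeightOneSpectrum (𝓞 K))) {q : HeightOneSpectrum (𝓞 K)} (hq : q ∈ D.primes)
    (hqn : q ∉ n) :
    Nat.card (D.atLevel 𝓕 n).selmerGroup ≤ p * Nat.card (D.atLevel 𝓕 (insert q n)).selmerGroup := by
  haveI := finite_selmerGroup_atLevel D 𝓕 hfin (insert q n)
  have h := natCard_selmerGroup_le_mul_of_ker_loc_le (𝓛 := D.atLevel 𝓕 (insert q n))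
    (𝓛' := D.atLevel 𝓕 n) q
    (fun x hx hx0 => (mem_selmerGroup_atLevel_insert_iff_of_localization_eq_zero D 𝓕 n q hx0).2 hx)
  rw [Level.atLevel_inr_of_not_mem D 𝓕 hqn, h𝓕.2 q (hPS q hq)] at h
  rw [← hU q hq]
  exact h

/-- **Sakamoto Lemma 6.1 (2) at `m = 1`: `#H^*(n) ≤ p · #H^*(n𝔮)`** for `𝔮 ∈ 𝒫 ∖ n` when
`χ(𝓕) = 1` (from (1) and `#H = p · #H^*` at both levels). [cite: Sakamoto2024, Lemma 6.1 (2) (p. 930)] -/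
theorem natCard_dualSelmerGroup_atLevel_le_insert {p : ℕ} [Fact p.Prime] {inv : LocalInvariants K p}
    (hperf : inv.IsPerfect) (hsum : inv.SumLocalTermEqZero) (hcompl : inv.SelmerComplement)
    (hM : ∀ m : M, p • m = 0) {S : Finset (Place K)}
    (hS : ∀ v : HeightOneSpectrum (𝓞 K), (Sum.inr v : Place K) ∉ S →
      ((p : ℕ) : 𝓞 K) ∉ v.asIdeal ∧ GaloisRep.IsUnramifiedAt v ρ)
    {𝓕 : SelmerStructure ρ} (h𝓕 : 𝓕.IsUnramifiedOutside S)
    (hfin : Finite 𝓕.selmerGroup) (hfind : Finite (inv.dualSelmerStructure ρ 𝓕).selmerGroup)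
    (hχ : LocalInvariants.HasCoreRank inv 𝓕 p 1)
    {D : KolyvaginDatum ρ} (hPS : ∀ q ∈ D.primes, (Sum.inr q : Place K) ∉ S)
    (hU : ∀ q ∈ D.primes, Nat.card (unramifiedSubgroup (GaloisRep.toLocal q ρ) 1) = p)
    (hT : ∀ q ∈ D.primes, Nat.card (D.transverse (Sum.inr q)) = p)
    {n : Finset (HeightOneSpectrum (𝓞 K))} (hn : D.IsLevel n) {q : HeightOneSpectrum (𝓞 K)}
    (hq : q ∈ D.primes) (hqn : q ∉ n) :
    Nat.card (inv.dualSelmerStructure ρ (D.atLevel 𝓕 n)).selmerGroup ≤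
      p * Nat.card (inv.dualSelmerStructure ρ (D.atLevel 𝓕 (insert q n))).selmerGroup := by
  have hp : 0 < p := (Fact.out : p.Prime).pos
  have h := natCard_selmerGroup_atLevel_le_insert h𝓕 hfin hPS hU n hq hqn
  rw [natCard_selmerGroup_atLevel_eq_mul hperf hsum hcompl hM hS h𝓕 hfin hfind hχ hPS hU hT hn,
    natCard_selmerGroup_atLevel_eq_mul hperf hsum hcompl hM hS h𝓕 hfin hfind hχ hPS hU hT
      (hn.insert hq)] at h
  exact Nat.le_of_mul_le_mul_left h hp

/-- **Sakamoto Lemma 6.1 (2) at `m = 1`: `#H^*(n𝔮) ≤ p · #H^*(n)`** when `χ(𝓕) = 1`.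
[cite: Sakamoto2024, Lemma 6.1 (2) (p. 930)] -/
theorem natCard_dualSelmerGroup_atLevel_insert_le {p : ℕ} [Fact p.Prime] {inv : LocalInvariants K p}
    (hperf : inv.IsPerfect) (hsum : inv.SumLocalTermEqZero) (hcompl : inv.SelmerComplement)
    (hM : ∀ m : M, p • m = 0) {S : Finset (Place K)}
    (hS : ∀ v : HeightOneSpectrum (𝓞 K), (Sum.inr v : Place K) ∉ S →
      ((p : ℕ) : 𝓞 K) ∉ v.asIdeal ∧ GaloisRep.IsUnramifiedAt v ρ)
    {𝓕 : SelmerStructure ρ} (h𝓕 : 𝓕.IsUnramifiedOutside S)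
    (hfin : Finite 𝓕.selmerGroup) (hfind : Finite (inv.dualSelmerStructure ρ 𝓕).selmerGroup)
    (hχ : LocalInvariants.HasCoreRank inv 𝓕 p 1)
    {D : KolyvaginDatum ρ} (hPS : ∀ q ∈ D.primes, (Sum.inr q : Place K) ∉ S)
    (hU : ∀ q ∈ D.primes, Nat.card (unramifiedSubgroup (GaloisRep.toLocal q ρ) 1) = p)
    (hT : ∀ q ∈ D.primes, Nat.card (D.transverse (Sum.inr q)) = p)
    {n : Finset (HeightOneSpectrum (𝓞 K))} (hn : D.IsLevel n) {q : HeightOneSpectrum (𝓞 K)}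
    (hq : q ∈ D.primes) :
    Nat.card (inv.dualSelmerStructure ρ (D.atLevel 𝓕 (insert q n))).selmerGroup ≤
      p * Nat.card (inv.dualSelmerStructure ρ (D.atLevel 𝓕 n)).selmerGroup := by
  have hp : 0 < p := (Fact.out : p.Prime).pos
  have h := natCard_selmerGroup_atLevel_insert_le hfin hT n hq
  rw [natCard_selmerGroup_atLevel_eq_mul hperf hsum hcompl hM hS h𝓕 hfin hfind hχ hPS hU hT hn,
    natCard_selmerGroup_atLevel_eq_mul hperf hsum hcompl hM hS h𝓕 hfin hfind hχ hPS hU hT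
      (hn.insert hq)] at h
  exact Nat.le_of_mul_le_mul_left h hp

/-- **`#H^*(1) ≤ p^{ν(n)} · #H^*(n)` for every level `n`** when `χ(𝓕) = 1` (Lemma 6.1 (2) iterated:
"In particular `ν(d) ≥ λ^*(1)` if `λ^*(d) = 0`"). [cite: Sakamoto2024, Lemma 6.1 (2) (p. 930)] -/
theorem natCard_dualSelmerGroup_le_pow_mul {p : ℕ} [Fact p.Prime] {inv : LocalInvariants K p}
    (hperf : inv.IsPerfect) (hsum : inv.SumLocalTermEqZero) (hcompl : inv.SelmerComplement)
    (hM : ∀ m : M, p • m = 0) {S : Finset (Place K)}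
    (hS : ∀ v : HeightOneSpectrum (𝓞 K), (Sum.inr v : Place K) ∉ S →
      ((p : ℕ) : 𝓞 K) ∉ v.asIdeal ∧ GaloisRep.IsUnramifiedAt v ρ)
    {𝓕 : SelmerStructure ρ} (h𝓕 : 𝓕.IsUnramifiedOutside S)
    (hfin : Finite 𝓕.selmerGroup) (hfind : Finite (inv.dualSelmerStructure ρ 𝓕).selmerGroup)
    (hχ : LocalInvariants.HasCoreRank inv 𝓕 p 1)
    {D : KolyvaginDatum ρ} (hPS : ∀ q ∈ D.primes, (Sum.inr q : Place K) ∉ S)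
    (hU : ∀ q ∈ D.primes, Nat.card (unramifiedSubgroup (GaloisRep.toLocal q ρ) 1) = p)
    (hT : ∀ q ∈ D.primes, Nat.card (D.transverse (Sum.inr q)) = p)
    {n : Finset (HeightOneSpectrum (𝓞 K))} (hn : D.IsLevel n) :
    Nat.card (inv.dualSelmerStructure ρ 𝓕).selmerGroup ≤
      p ^ n.card * Nat.card (inv.dualSelmerStructure ρ (D.atLevel 𝓕 n)).selmerGroup := by
  classical
  induction n using Finset.induction_on with
  | empty =>
    have h0 : D.atLevel 𝓕 ∅ = 𝓕 := SelmerStructure.modify_empty 𝓕 D.transverse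
    rw [h0, Finset.card_empty, pow_zero, one_mul]
  | insert q n hqn ih =>
    have hn' : D.IsLevel n ∧ q ∈ D.primes := by
      simp only [KolyvaginDatum.IsLevel, Finset.coe_insert, Set.insert_subset_iff] at hn
      exact ⟨hn.2, hn.1⟩
    calc Nat.card (inv.dualSelmerStructure ρ 𝓕).selmerGroup
        ≤ p ^ n.card * Nat.card (inv.dualSelmerStructure ρ (D.atLevel 𝓕 n)).selmerGroup := ih hn'.1
      _ ≤ p ^ n.card * (p * Nat.card (inv.dualSelmerStructure ρ (D.atLevel 𝓕 (insert q n))).selmerGroup) :=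
          Nat.mul_le_mul_left _ (natCard_dualSelmerGroup_atLevel_le_insert hperf hsum hcompl hM hS h𝓕
            hfin hfind hχ hPS hU hT hn'.1 hn'.2 hqn)
      _ = p ^ (insert q n).card *
            Nat.card (inv.dualSelmerStructure ρ (D.atLevel 𝓕 (insert q n))).selmerGroup := by
          rw [Finset.card_insert_of_notMem hqn, pow_succ]; ring

/-! ## §5. The edges of `X⁰` at `m = 1` -/
/-- **(M1) Stepping up along an edge of `X⁰`.**  If `n` is a core vertex (`H^*(n) = 0`) and some
class of `H(n)` is non-zero at the Kolyvagin prime `𝔮` (`𝔮 ∉ n` in the application) — Sakamoto's edge condition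
"`H¹_{𝓕(n)}(K,T̄) ≠ H¹_{𝓕_𝔮(n)}(K,T̄)`" — then `n𝔮` is a core vertex and `loc_𝔮` is injective on
`H(n𝔮)` (Rubin, proof of Thm. 2.8.5 / Ex. 2.8.3: "`Res_ℓ : H¹_{𝓕(n)}(ℚ,A) → H¹_u(ℚ_ℓ,A)` is surjective,
and so … an isomorphism"; at `m = 1`: `H(n) ∩ ker loc_𝔮 = 0`, so `H(n𝔮) ↪ H¹_tr(K_𝔮, M)` has order
`≤ p = p·#H^*(n𝔮)`). [cite: Sakamoto2024, §6 (p. 930) and Lemma 6.1 (3)]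
[cite: Rubin2011, Exercise 2.8.3 and proof of Thm. 2.8.5 (pp. 24–25)] -/
theorem core_insert_of_localization_ne_zero {p : ℕ} [Fact p.Prime] {inv : LocalInvariants K p}
    (hperf : inv.IsPerfect) (hsum : inv.SumLocalTermEqZero) (hcompl : inv.SelmerComplement)
    (hM : ∀ m : M, p • m = 0) {S : Finset (Place K)}
    (hS : ∀ v : HeightOneSpectrum (𝓞 K), (Sum.inr v : Place K) ∉ S →
      ((p : ℕ) : 𝓞 K) ∉ v.asIdeal ∧ GaloisRep.IsUnramifiedAt v ρ)
    {𝓕 : SelmerStructure ρ} (h𝓕 : 𝓕.IsUnramifiedOutside S)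
    (hfin : Finite 𝓕.selmerGroup) (hfind : Finite (inv.dualSelmerStructure ρ 𝓕).selmerGroup)
    (hχ : LocalInvariants.HasCoreRank inv 𝓕 p 1)
    {D : KolyvaginDatum ρ} (hPS : ∀ q ∈ D.primes, (Sum.inr q : Place K) ∉ S)
    (hU : ∀ q ∈ D.primes, Nat.card (unramifiedSubgroup (GaloisRep.toLocal q ρ) 1) = p)
    (hT : ∀ q ∈ D.primes, Nat.card (D.transverse (Sum.inr q)) = p)
    {n : Finset (HeightOneSpectrum (𝓞 K))} (hn : D.IsLevel n)
    (hcore : (inv.dualSelmerStructure ρ (D.atLevel 𝓕 n)).selmerGroup = ⊥)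
    {q : HeightOneSpectrum (𝓞 K)} (hq : q ∈ D.primes)
    {x : galoisCohomology ρ 1} (hx : x ∈ (D.atLevel 𝓕 n).selmerGroup)
    (hxq : galoisCohomology.localization ρ (Sum.inr q) 1 x ≠ 0) :
    (inv.dualSelmerStructure ρ (D.atLevel 𝓕 (insert q n))).selmerGroup = ⊥ ∧
      ∀ z ∈ (D.atLevel 𝓕 (insert q n)).selmerGroup,
        galoisCohomology.localization ρ (Sum.inr q) 1 z = 0 → z = 0 := by
  have hp : p.Prime := Fact.out
  have hcardn := natCard_selmerGroup_atLevel_of_core hperf hsum hcompl hM hS h𝓕 hfin hfind hχ hPS hU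
    hT hn hcore
  have hker : (D.atLevel 𝓕 n).selmerGroup ⊓ (galoisCohomology.localization ρ (Sum.inr q) 1).ker = ⊥ :=
    eq_bot_of_le_of_natCard_eq_prime_of_not_mem hp inf_le_left hcardn hx
      fun h => hxq ((AddMonoidHom.mem_ker).1 h.2)
  have hinj : ∀ z ∈ (D.atLevel 𝓕 (insert q n)).selmerGroup,
      galoisCohomology.localization ρ (Sum.inr q) 1 z = 0 → z = 0 := by
    intro z hz hz0
    have hz' : z ∈ (D.atLevel 𝓕 n).selmerGroup ⊓ (galoisCohomology.localization ρ (Sum.inr q) 1).ker :=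
      ⟨(mem_selmerGroup_atLevel_insert_iff_of_localization_eq_zero D 𝓕 n q hz0).1 hz,
        (AddMonoidHom.mem_ker).2 hz0⟩
    rw [hker] at hz'
    exact (AddSubgroup.mem_bot).1 hz'
  refine ⟨?_, hinj⟩
  -- `#H(n𝔮) ≤ #H¹_tr = p`, and `#H(n𝔮) = p · #H^*(n𝔮)`, so `#H^*(n𝔮) ≤ 1`
  haveI := finite_dualSelmerGroup_atLevel inv D 𝓕 hfind (insert q n)
  have hle : Nat.card (D.atLevel 𝓕 (insert q n)).selmerGroup ≤ p := by
    have h := natCard_selmerGroup_le_of_loc_injective (𝓛' := D.atLevel 𝓕 (insert q n)) q hinj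
    rwa [Level.atLevel_insert_inr_self, hT q hq] at h
  rw [natCard_selmerGroup_atLevel_eq_mul hperf hsum hcompl hM hS h𝓕 hfin hfind hχ hPS hU hT
    (hn.insert hq)] at hle
  have h1 : Nat.card (inv.dualSelmerStructure ρ (D.atLevel 𝓕 (insert q n))).selmerGroup ≤ 1 :=
    Nat.le_of_mul_le_mul_left (by simpa using hle) hp.pos
  exact AddSubgroup.card_eq_one.1 (le_antisymm h1 Nat.card_pos)

/-- **(M2) Stepping down along an edge of `X⁰`.**  If `n𝔮` is a core vertex (`𝔮 ∈ 𝒫 ∖ n`) and some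
class of `H(n𝔮)` is non-zero at `𝔮`, then `n` is a core vertex, `loc_𝔮` is injective on `H(n)` and
non-zero there — so `n — n𝔮` is an edge of `X⁰` seen from `n` (Rubin Def. 2.8.6: both vertex-to-edge
maps are isomorphisms; the `m = 1` argument of (M1) with the rôles of `H¹_ur` and `H¹_tr` exchanged).
[cite: Rubin2011, Def. 2.8.6 (p. 25)] [cite: Sakamoto2024, §6 (p. 930)] -/
theorem core_of_core_insert_of_localization_ne_zero {p : ℕ} [Fact p.Prime] {inv : LocalInvariants K p}
    (hperf : inv.IsPerfect) (hsum : inv.SumLocalTermEqZero) (hcompl : inv.SelmerComplement)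
    (hM : ∀ m : M, p • m = 0) {S : Finset (Place K)}
    (hS : ∀ v : HeightOneSpectrum (𝓞 K), (Sum.inr v : Place K) ∉ S →
      ((p : ℕ) : 𝓞 K) ∉ v.asIdeal ∧ GaloisRep.IsUnramifiedAt v ρ)
    {𝓕 : SelmerStructure ρ} (h𝓕 : 𝓕.IsUnramifiedOutside S)
    (hfin : Finite 𝓕.selmerGroup) (hfind : Finite (inv.dualSelmerStructure ρ 𝓕).selmerGroup)
    (hχ : LocalInvariants.HasCoreRank inv 𝓕 p 1)
    {D : KolyvaginDatum ρ} (hPS : ∀ q ∈ D.primes, (Sum.inr q : Place K) ∉ S)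
    (hU : ∀ q ∈ D.primes, Nat.card (unramifiedSubgroup (GaloisRep.toLocal q ρ) 1) = p)
    (hT : ∀ q ∈ D.primes, Nat.card (D.transverse (Sum.inr q)) = p)
    {n : Finset (HeightOneSpectrum (𝓞 K))} (hn : D.IsLevel n)
    {q : HeightOneSpectrum (𝓞 K)} (hq : q ∈ D.primes) (hqn : q ∉ n)
    (hcore : (inv.dualSelmerStructure ρ (D.atLevel 𝓕 (insert q n))).selmerGroup = ⊥)
    {z : galoisCohomology ρ 1} (hz : z ∈ (D.atLevel 𝓕 (insert q n)).selmerGroup)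
    (hzq : galoisCohomology.localization ρ (Sum.inr q) 1 z ≠ 0) :
    (inv.dualSelmerStructure ρ (D.atLevel 𝓕 n)).selmerGroup = ⊥ ∧
      (∃ x ∈ (D.atLevel 𝓕 n).selmerGroup, galoisCohomology.localization ρ (Sum.inr q) 1 x ≠ 0) ∧
      ∀ x ∈ (D.atLevel 𝓕 n).selmerGroup, galoisCohomology.localization ρ (Sum.inr q) 1 x = 0 → x = 0 := by
  have hp : p.Prime := Fact.out
  have hcardnq := natCard_selmerGroup_atLevel_of_core hperf hsum hcompl hM hS h𝓕 hfin hfind hχ hPS hU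
    hT (hn.insert hq) hcore
  have hker : (D.atLevel 𝓕 (insert q n)).selmerGroup ⊓
      (galoisCohomology.localization ρ (Sum.inr q) 1).ker = ⊥ :=
    eq_bot_of_le_of_natCard_eq_prime_of_not_mem hp inf_le_left hcardnq hz
      fun h => hzq ((AddMonoidHom.mem_ker).1 h.2)
  have hinj : ∀ x ∈ (D.atLevel 𝓕 n).selmerGroup,
      galoisCohomology.localization ρ (Sum.inr q) 1 x = 0 → x = 0 := by
    intro x hx hx0
    have hx' : x ∈ (D.atLevel 𝓕 (insert q n)).selmerGroup ⊓
        (galoisCohomology.localization ρ (Sum.inr q) 1).ker :=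
      ⟨(mem_selmerGroup_atLevel_insert_iff_of_localization_eq_zero D 𝓕 n q hx0).2 hx,
        (AddMonoidHom.mem_ker).2 hx0⟩
    rw [hker] at hx'
    exact (AddSubgroup.mem_bot).1 hx'
  haveI := finite_dualSelmerGroup_atLevel inv D 𝓕 hfind n
  have hle : Nat.card (D.atLevel 𝓕 n).selmerGroup ≤ p := by
    have h := natCard_selmerGroup_le_of_loc_injective (𝓛' := D.atLevel 𝓕 n) q hinj
    rw [Level.atLevel_inr_of_not_mem D 𝓕 hqn, h𝓕.2 q (hPS q hq)] at h
    rw [← hU q hq]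
    exact h
  rw [natCard_selmerGroup_atLevel_eq_mul hperf hsum hcompl hM hS h𝓕 hfin hfind hχ hPS hU hT hn] at hle
  have h1 : Nat.card (inv.dualSelmerStructure ρ (D.atLevel 𝓕 n)).selmerGroup ≤ 1 :=
    Nat.le_of_mul_le_mul_left (by simpa using hle) hp.pos
  have hcoren : (inv.dualSelmerStructure ρ (D.atLevel 𝓕 n)).selmerGroup = ⊥ :=
    AddSubgroup.card_eq_one.1 (le_antisymm h1 Nat.card_pos)
  refine ⟨hcoren, ?_, hinj⟩
  -- `H(n)` has order `p > 1`, so it has a non-zero class, non-zero at `𝔮` by injectivity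
  have hcardn := natCard_selmerGroup_atLevel_of_core hperf hsum hcompl hM hS h𝓕 hfin hfind hχ hPS hU
    hT hn hcoren
  have hne : (D.atLevel 𝓕 n).selmerGroup ≠ ⊥ := fun h => hp.one_lt.ne' (by
    rw [← hcardn, h, AddSubgroup.card_bot])
  obtain ⟨x, hx, hx0⟩ := (AddSubgroup.bot_or_exists_ne_zero _).resolve_left hne
  exact ⟨x, hx, fun h => hx0 (hinj x hx h)⟩
section Theta

variable {p : ℕ} (θ : ρ.toContRepresentation →ⁱL (ρ.tateDual p).toContRepresentation)
  (θ' : (ρ.tateDual p).toContRepresentation →ⁱL ρ.toContRepresentation)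

/-- **(F4) Sakamoto Lemma 6.1 (4) at `m = 1`.**  If `#H^*(e) = p` and some class `y` of the
θ-transported dual Selmer group `H¹_{θ^*𝓕(e)^*}(K, M)` (which lies in `H(e)` by coisotropy) is
non-zero at the Kolyvagin prime `r ∉ e`, then `er` is a core vertex: "If
`H¹_{𝓕^*(d)}(K,T̄) ≠ H¹_{(𝓕^*)_𝔮(d)}(K,T̄)`, then `λ(d𝔮) = λ(d) − 1` and `λ^*(d𝔮) = λ^*(d) − 1`" — here
`H^*(er) ≤ H^*(e)` (R1-16 `dualSelmerGroup_strictAt_eq`, the class `y ∈ H(e)` being non-zero at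
`r`) misses `H¹(θ) y`, whose localisation at `r` would lie in `(H¹_ur)^* ∩ (H¹_tr)^* = 0`.
[cite: Sakamoto2024, Lemma 6.1 (4) (p. 930)] [cite: Rubin2011, Cor. 2.6.2 (4) (p. 23)] -/
theorem core_insert_of_dualTransported_localization_ne_zero [Fact p.Prime]
    {inv : LocalInvariants K p}
    (hperf : inv.IsPerfect) (hsum : inv.SumLocalTermEqZero) (hcompl : inv.SelmerComplement)
    (hur : inv.UnramifiedOrthogonal) (hM : ∀ m : M, p • m = 0) {S : Finset (Place K)}
    (hS : ∀ v : HeightOneSpectrum (𝓞 K), (Sum.inr v : Place K) ∉ S →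
      ((p : ℕ) : 𝓞 K) ∉ v.asIdeal ∧ GaloisRep.IsUnramifiedAt v ρ)
    {𝓕 : SelmerStructure ρ} (h𝓕 : 𝓕.IsUnramifiedOutside S)
    (hfin : Finite 𝓕.selmerGroup) (hfind : Finite (inv.dualSelmerStructure ρ 𝓕).selmerGroup)
    (hθθ' : ∀ a : M, θ' (θ a) = a) (hcois : inv.IsResiduallyCoisotropic 𝓕 θ S)
    {D : KolyvaginDatum ρ} (hPS : ∀ q ∈ D.primes, (Sum.inr q : Place K) ∉ S)
    (hU : ∀ q ∈ D.primes, Nat.card (unramifiedSubgroup (GaloisRep.toLocal q ρ) 1) = p)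
    (hUT : ∀ q ∈ D.primes,
      unramifiedSubgroup (GaloisRep.toLocal q ρ) 1 ⊔ D.transverse (Sum.inr q) = ⊤)
    (hTθ : ∀ q ∈ D.primes, (inv.dualLocalCondition ρ (Sum.inr q) (D.transverse (Sum.inr q))).comap
      (localMap θ (Sum.inr q)) = D.transverse (Sum.inr q))
    {e : Finset (HeightOneSpectrum (𝓞 K))} (he : D.IsLevel e)
    (hcard : Nat.card (inv.dualSelmerStructure ρ (D.atLevel 𝓕 e)).selmerGroup = p)
    {y : galoisCohomology ρ 1} (hy : y ∈ (inv.dualTransported (D.atLevel 𝓕 e) θ).selmerGroup)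
    {r : HeightOneSpectrum (𝓞 K)} (hr : r ∈ D.primes) (hre : r ∉ e)
    (hyr : galoisCohomology.localization ρ (Sum.inr r) 1 y ≠ 0) :
    (inv.dualSelmerStructure ρ (D.atLevel 𝓕 (insert r e))).selmerGroup = ⊥ := by
  have hp : p.Prime := Fact.out
  haveI := DiscreteGaloisModule.TateDual.finite K M p
  -- `y ∈ H(e)` by coisotropy, and `H¹(θ) y ∈ H^*(e)` is non-zero at `r`
  have hyH : y ∈ (D.atLevel 𝓕 e).selmerGroup :=
    selmerGroup_dualTransported_atLevel_le θ θ' hur hM hS h𝓕 hθθ' hcois hTθ he hy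
  have hy' : galoisCohomology.map θ 1 y ∈ (inv.dualSelmerStructure ρ (D.atLevel 𝓕 e)).selmerGroup :=
    (mem_selmerGroup_dualTransported_iff θ inv _ y).1 hy
  have hy'r : galoisCohomology.localization (ρ.tateDual p) (Sum.inr r) 1 (galoisCohomology.map θ 1 y) ≠ 0 :=
    (localization_map_ne_zero_iff θ θ' hθθ' _ y).2 hyr
  -- `H^*(er) ≤ H¹_{𝓕_r(e)^*} = H^*(e)` (R1-16 `dualSelmerGroup_strictAt_eq`)
  have hEq := dualSelmerGroup_strictAt_eq hperf hsum hcompl hM hS h𝓕 hfin hfind hPS hU e hr hre hyH hyr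
  have hle : (inv.dualSelmerStructure ρ (D.atLevel 𝓕 (insert r e))).selmerGroup ≤
      (inv.dualSelmerStructure ρ (D.atLevel 𝓕 e)).selmerGroup := by
    intro z hz
    have hzA : z ∈ (inv.dualSelmerStructure ρ ((D.atLevel 𝓕 e).strictAt {r})).selmerGroup := by
      refine mem_selmerGroup_of_forall_ne r (fun v hv => le_of_eq ?_) hz ?_
      · rw [LocalInvariants.dualSelmerStructure_apply, LocalInvariants.dualSelmerStructure_apply,
          Level.atLevel_insert_apply_of_ne D 𝓕 r hv, Level.strictAt_apply_of_ne _ r hv]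
      · rw [LocalInvariants.dualSelmerStructure_apply, Level.strictAt_inr_self,
          LocalInvariants.dualLocalCondition_bot]
        exact AddSubgroup.mem_top _
    rwa [hEq] at hzA
  -- `H¹(θ) y ∉ H^*(er)`: its localisation at `r` would lie in `(H¹_ur)^* ⊓ (H¹_tr)^* = 0`
  refine eq_bot_of_le_of_natCard_eq_prime_of_not_mem hp hle hcard hy' fun hmem => hy'r ?_
  have h1 := (SelmerStructure.mem_selmerGroup_iff _ _).1 hy' (Sum.inr r)
  rw [LocalInvariants.dualSelmerStructure_apply, Level.atLevel_inr_of_not_mem D 𝓕 hre,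
    h𝓕.2 r (hPS r hr)] at h1
  have h2 := (SelmerStructure.mem_selmerGroup_iff _ _).1 hmem (Sum.inr r)
  rw [LocalInvariants.dualSelmerStructure_apply, Level.atLevel_insert_inr_self] at h2
  have h12 := AddSubgroup.mem_inf.2 ⟨h1, h2⟩
  rwa [dual_unramified_inf_dual_transverse_eq_bot hperf hM hUT hr, AddSubgroup.mem_bot] at h12

end Theta

end Summit.BirchSwinnertonDyer.Rank1Residual.GaloisImage.CoreRankOne

end
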